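import Summits.NavierStokesRegularity.NavierStokesRegularity.Theorems.ExtremiserTransienceNearExtremalTransienceExtremiserLiouvilleConstantSpeedCalculus
import HarnessLib

/-!
# Crux `ExtremiserTransience.NearExtremalTransience` (stmt-NavierStokesRegularity-21883), line `extremiser_liouville`,
# stub K1b — THE CAUCHY STEP OF THE JET ENDGAME: vertical translation is controlled by the vertical Dirichlet energy

`--supports stmt-NavierStokesRegularity-21883` (helper).  Author: prover seat `ns-el-k1b` (g8).  Record:
`Cruxes/NearExtremalTransience/Lines/extremiser_liouville_k1b_slide.md` §5 (endgame).

The endgame of the jet kill compares the plane profiles of `V = w − c` at different heights.  The elementary step, in the 3-D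
weighted form used throughout this line (no disintegration into planes):
* `norm_sub_translate_sq_le_integral` : **`‖V(x + e₂) − V(x)‖² ≤ ∫₀¹ ‖∂₂V(x + t e₂)‖² dt`** for `V ∈ C¹` (fundamental theorem
  along the vertical segment, then `‖d‖² = ∫₀¹⟪d, ∂₂V(x+te₂)⟫dt ≤ ½‖d‖² + ½∫₀¹‖∂₂V‖²` — no Jensen needed);
* `lintegral_weight_norm_sub_translate_sq_le` : for a continuous weight `0 ≤ ρ`:
  **`∫⁻ ρ(x)‖V(x+e₂) − V(x)‖² dx ≤ ∫⁻_{t∈(0,1]} ∫⁻ ρ(y − t e₂)‖∂₂V(y)‖² dy dt`** (Tonelli + translation invariance), hence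
* `lintegral_weight_norm_sub_translate_sq_le_of_le` : if every translated window Dirichlet energy `∫ρ(y − te₂)‖∂₂V(y)‖²dy`,
  `t ∈ (0,1]`, is `≤ δ`, then `∫⁻ ρ‖V(·+e₂) − V‖² ≤ δ`.
With `ρ(x) = H′(x₂ − s)` (the window weight of the energy-flux invariance) this is the unit step of record §5: the window `L²`
distance between the profile and its unit vertical translate is bounded by the window Dirichlet energies on `[s, s+1]`, which
(DEC) makes summable in `s` — while the window energy itself is the constant `E₀ > 0` and `V → 0` uniformly.

WHAT THIS IS NOT: K1b is NOT proved; nothing here proves NS regularity. [folklore]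
-/

noncomputable section

open Set Filter Topology MeasureTheory Metric Function InnerProductSpace intervalIntegral
open scoped ENNReal NNReal Topology InnerProductSpace RealInnerProductSpace ContDiff

namespace Summit.NavierStokesRegularity.NavierStokesRegularity.Theorems

-- the problem directory repeats the summit name (`NavierStokesRegularity/NavierStokesRegularity`)
set_option linter.dupNamespace false

namespace ExtremiserLiouville

variable {V : EuclideanSpace ℝ (Fin 3) → EuclideanSpace ℝ (Fin 3)} {ρ : EuclideanSpace ℝ (Fin 3) → ℝ}

/-! ## 1. The pointwise step -/

/-- The vertical segment `t ↦ V(x + t e₂)` has derivative `∂₂V(x + t e₂)`. [folklore] -/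
theorem hasDerivAt_comp_add_smul (hVd : Differentiable ℝ V) (x : EuclideanSpace ℝ (Fin 3)) (t : ℝ) :
    HasDerivAt (fun t : ℝ => V (x + t • EuclideanSpace.single (2 : Fin 3) (1 : ℝ)))
      (fderiv ℝ V (x + t • EuclideanSpace.single (2 : Fin 3) (1 : ℝ)) (EuclideanSpace.single (2 : Fin 3) (1 : ℝ))) t := by
  set e₂ : EuclideanSpace ℝ (Fin 3) := EuclideanSpace.single (2 : Fin 3) (1 : ℝ) with he₂
  have hl : HasDerivAt (fun t : ℝ => x + t • e₂) ((1 : ℝ) • e₂) t := ((hasDerivAt_id t).smul_const e₂).const_add x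
  rw [one_smul] at hl
  exact (hVd (x + t • e₂)).hasFDerivAt.comp_hasDerivAt t hl

/-- **`‖V(x + e₂) − V(x)‖² ≤ ∫₀¹ ‖∂₂V(x + t e₂)‖² dt`** for `V ∈ C¹`. [folklore] -/
theorem norm_sub_translate_sq_le_integral (hV : ContDiff ℝ 1 V) (x : EuclideanSpace ℝ (Fin 3)) :
    ‖V (x + EuclideanSpace.single (2 : Fin 3) (1 : ℝ)) - V x‖ ^ 2 ≤
      ∫ t in (0 : ℝ)..1, ‖fderiv ℝ V (x + t • EuclideanSpace.single (2 : Fin 3) (1 : ℝ)) (EuclideanSpace.single (2 : Fin 3) (1 : ℝ))‖ ^ 2 := by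
  set e₂ : EuclideanSpace ℝ (Fin 3) := EuclideanSpace.single (2 : Fin 3) (1 : ℝ) with he₂
  have hVd : Differentiable ℝ V := hV.differentiable one_ne_zero
  set c' : ℝ → EuclideanSpace ℝ (Fin 3) := fun t => fderiv ℝ V (x + t • e₂) e₂ with hc'
  have hc'c : Continuous c' :=
    ((hV.continuous_fderiv one_ne_zero).comp (continuous_const.add (continuous_id.smul continuous_const))).clm_apply
      continuous_const
  -- fundamental theorem along the segment
  have hftc : ∫ t in (0 : ℝ)..1, c' t = V (x + e₂) - V x := by
    have h := integral_eq_sub_of_hasDerivAt (a := (0 : ℝ)) (b := 1) (f := fun t : ℝ => V (x + t • e₂)) (f' := c')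
      (fun t _ => hasDerivAt_comp_add_smul hVd x t) (hc'c.intervalIntegrable 0 1)
    simpa using h
  set d : EuclideanSpace ℝ (Fin 3) := V (x + e₂) - V x with hd
  -- `‖d‖² = ∫⟪d, c'⟫ ≤ ½‖d‖² + ½∫‖c'‖²`
  have hi : IntervalIntegrable c' volume 0 1 := hc'c.intervalIntegrable 0 1
  have hi2 : IntervalIntegrable (fun t => ‖c' t‖ ^ 2) volume 0 1 := (hc'c.norm.pow 2).intervalIntegrable 0 1
  have hinner : ‖d‖ ^ 2 = ∫ t in (0 : ℝ)..1, ⟪d, c' t⟫ := by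
    rw [intervalIntegral.integral_of_le zero_le_one, integral_inner (hi.1) d, ← intervalIntegral.integral_of_le zero_le_one,
      hftc, real_inner_self_eq_norm_sq]
  have hpt : ∀ t, ⟪d, c' t⟫ ≤ ‖d‖ ^ 2 / 2 + ‖c' t‖ ^ 2 / 2 := fun t => by
    nlinarith [real_inner_le_norm d (c' t), sq_nonneg (‖d‖ - ‖c' t‖), norm_nonneg d, norm_nonneg (c' t)]
  have hle : (∫ t in (0 : ℝ)..1, ⟪d, c' t⟫) ≤ ∫ t in (0 : ℝ)..1, (‖d‖ ^ 2 / 2 + ‖c' t‖ ^ 2 / 2) :=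
    intervalIntegral.integral_mono_on zero_le_one ((continuous_const.inner hc'c).intervalIntegrable 0 1)
      ((continuous_const.add ((hc'c.norm.pow 2).div_const 2)).intervalIntegrable 0 1) fun t _ => hpt t
  rw [intervalIntegral.integral_add intervalIntegrable_const (hi2.div_const 2), intervalIntegral.integral_const,
    intervalIntegral.integral_div, sub_zero, one_smul] at hle
  have : (∫ t in (0 : ℝ)..1, ‖c' t‖ ^ 2) = ∫ t in (0 : ℝ)..1, ‖fderiv ℝ V (x + t • e₂) e₂‖ ^ 2 := rfl
  linarith

/-! ## 2. The weighted, integrated step -/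

/-- **`∫⁻ ρ(x)‖V(x+e₂) − V(x)‖² ≤ ∫⁻_{t∈(0,1]} ∫⁻ ρ(y − te₂)‖∂₂V(y)‖² dy dt`** for `V ∈ C¹` and a continuous weight `ρ ≥ 0`
(pointwise step, Tonelli, translation invariance of Lebesgue measure). [folklore] -/
theorem lintegral_weight_norm_sub_translate_sq_le (hV : ContDiff ℝ 1 V) (hρ : Continuous ρ) (hρ0 : ∀ x, 0 ≤ ρ x) :
    ∫⁻ x, ENNReal.ofReal (ρ x * ‖V (x + EuclideanSpace.single (2 : Fin 3) (1 : ℝ)) - V x‖ ^ 2) ≤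
      ∫⁻ t in Ioc (0 : ℝ) 1, ∫⁻ y, ENNReal.ofReal (ρ (y - t • EuclideanSpace.single (2 : Fin 3) (1 : ℝ)) *
        ‖fderiv ℝ V y (EuclideanSpace.single (2 : Fin 3) (1 : ℝ))‖ ^ 2) := by
  set e₂ : EuclideanSpace ℝ (Fin 3) := EuclideanSpace.single (2 : Fin 3) (1 : ℝ) with he₂
  have hVd : Differentiable ℝ V := hV.differentiable one_ne_zero
  have cDV : Continuous (fderiv ℝ V) := hV.continuous_fderiv one_ne_zero
  -- the two-variable integrand
  set F : EuclideanSpace ℝ (Fin 3) → ℝ → ℝ≥0∞ := fun x t => ENNReal.ofReal (ρ x * ‖fderiv ℝ V (x + t • e₂) e₂‖ ^ 2) with hF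
  have hFm : AEMeasurable (uncurry F) ((volume : Measure (EuclideanSpace ℝ (Fin 3))).prod ((volume : Measure ℝ).restrict (Ioc 0 1))) := by
    refine (ENNReal.measurable_ofReal.comp (Continuous.measurable ?_)).aemeasurable
    have h1 : Continuous fun p : EuclideanSpace ℝ (Fin 3) × ℝ => fderiv ℝ V (p.1 + p.2 • e₂) e₂ :=
      (cDV.comp (continuous_fst.add (continuous_snd.smul continuous_const))).clm_apply continuous_const
    exact (hρ.comp continuous_fst).mul (h1.norm.pow 2)
  -- step 1: pointwise
  have hstep : ∀ x, ENNReal.ofReal (ρ x * ‖V (x + e₂) - V x‖ ^ 2) ≤ ∫⁻ t in Ioc (0 : ℝ) 1, F x t := by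
    intro x
    have hpt := norm_sub_translate_sq_le_integral hV x
    have hc : Continuous fun t : ℝ => ‖fderiv ℝ V (x + t • e₂) e₂‖ ^ 2 :=
      ((cDV.comp (continuous_const.add (continuous_id.smul continuous_const))).clm_apply continuous_const).norm.pow 2
    have hi : IntegrableOn (fun t : ℝ => ρ x * ‖fderiv ℝ V (x + t • e₂) e₂‖ ^ 2) (Ioc 0 1) volume :=
      ((continuous_const.mul hc).integrableOn_Icc (a := 0) (b := 1)).mono_set Ioc_subset_Icc_self
    calc ENNReal.ofReal (ρ x * ‖V (x + e₂) - V x‖ ^ 2)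
        ≤ ENNReal.ofReal (∫ t in Ioc (0 : ℝ) 1, ρ x * ‖fderiv ℝ V (x + t • e₂) e₂‖ ^ 2) := by
          refine ENNReal.ofReal_le_ofReal ?_
          rw [MeasureTheory.integral_const_mul, ← intervalIntegral.integral_of_le zero_le_one]
          exact mul_le_mul_of_nonneg_left hpt (hρ0 x)
      _ = ∫⁻ t in Ioc (0 : ℝ) 1, F x t := by
          rw [ofReal_integral_eq_lintegral_ofReal hi (Eventually.of_forall fun t => mul_nonneg (hρ0 x) (sq_nonneg _))]
  -- step 2: Tonelli and translation
  calc ∫⁻ x, ENNReal.ofReal (ρ x * ‖V (x + e₂) - V x‖ ^ 2)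
      ≤ ∫⁻ x, ∫⁻ t in Ioc (0 : ℝ) 1, F x t := lintegral_mono hstep
    _ = ∫⁻ t in Ioc (0 : ℝ) 1, ∫⁻ x, F x t := lintegral_lintegral_swap hFm
    _ = ∫⁻ t in Ioc (0 : ℝ) 1, ∫⁻ y, ENNReal.ofReal (ρ (y - t • e₂) * ‖fderiv ℝ V y e₂‖ ^ 2) := by
        refine setLIntegral_congr_fun measurableSet_Ioc (fun t _ => ?_)
        have h := lintegral_add_right_eq_self (μ := (volume : Measure (EuclideanSpace ℝ (Fin 3))))
          (fun y => ENNReal.ofReal (ρ (y - t • e₂) * ‖fderiv ℝ V y e₂‖ ^ 2)) (t • e₂)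
        rw [← h]
        refine lintegral_congr fun x => ?_
        simp only [hF, add_sub_cancel_right]

/-- **Consequence**: if every translated window Dirichlet energy is `≤ δ` on `t ∈ (0,1]`, then
`∫⁻ ρ‖V(·+e₂) − V‖² ≤ δ`. [folklore] -/
theorem lintegral_weight_norm_sub_translate_sq_le_of_le (hV : ContDiff ℝ 1 V) (hρ : Continuous ρ) (hρ0 : ∀ x, 0 ≤ ρ x)
    {δ : ℝ} (hδ : ∀ t ∈ Ioc (0 : ℝ) 1,
      ∫⁻ y, ENNReal.ofReal (ρ (y - t • EuclideanSpace.single (2 : Fin 3) (1 : ℝ)) *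
        ‖fderiv ℝ V y (EuclideanSpace.single (2 : Fin 3) (1 : ℝ))‖ ^ 2) ≤ ENNReal.ofReal δ) :
    ∫⁻ x, ENNReal.ofReal (ρ x * ‖V (x + EuclideanSpace.single (2 : Fin 3) (1 : ℝ)) - V x‖ ^ 2) ≤ ENNReal.ofReal δ := by
  refine (lintegral_weight_norm_sub_translate_sq_le hV hρ hρ0).trans ?_
  calc ∫⁻ t in Ioc (0 : ℝ) 1, ∫⁻ y, ENNReal.ofReal (ρ (y - t • EuclideanSpace.single (2 : Fin 3) (1 : ℝ)) *
          ‖fderiv ℝ V y (EuclideanSpace.single (2 : Fin 3) (1 : ℝ))‖ ^ 2)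
      ≤ ∫⁻ t in Ioc (0 : ℝ) 1, ENNReal.ofReal δ := setLIntegral_mono measurable_const hδ
    _ = ENNReal.ofReal δ := by
        rw [setLIntegral_const, Real.volume_Ioc, sub_zero, ENNReal.ofReal_one, mul_one]

end ExtremiserLiouville

end Summit.NavierStokesRegularity.NavierStokesRegularity.Theorems

end
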